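import Summits.BirchSwinnertonDyer.BirchSwinnertonDyer.Theses.InertBadSignedBranches
import Summits.BirchSwinnertonDyer.BirchSwinnertonDyer.Theorems.InertBadSignedBranchesPlusMCEtaKUpToMu
import HarnessLib

/-!
# Route `InertBadSignedBranches` (rung K8): the by-name split of item 19501 `PlusMCEtaK` is LOSSLESS

HONEST FRAMING (cell bsd-cm): BSD is NOT proved by any of this; nothing here closes an item or a cell,
and no label moves. This file is the item-level RECORD announced in the docstrings of the split children
(planner bsd-cm-plan g20, D119; sketch abb6e17280a56113, which is not a tree file): under the published
inputs `PublishedInputsEtaUpToP` (item 19867: Burungale–Tian 2026 Thm. 2.6 read on Kobayashi's `η`-exact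
sequences ∧ Kobayashi 2003 Thm. 2.2 at `η`, both NAMED HYPOTHESES, booked nowhere as known) the parent
crux 19501 `PlusMCEtaK` (Kobayashi's even `η`-main conjecture, verbatim frame) and its residual child
19865 `PlusMCEtaKMuPart` (the `μ`-equality) are EQUIVALENT — so the residual declaration carried by 19865
is exact, neither a weakening nor a strengthening of 19501 modulo print. Both directions are the pointwise
content of the landed kernel iff `Theorems.PlusMCEtaKUpToMu.plusMCEtaK_iff_muInvariant_eq_of_burungaleTian`
(p473177 = Burungale–Tian 2026 §4 `μ`-criterion on the route's datum); the support child 19866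
`PlusMCEtaKUpToMu` holds outright (closer `Theorems.PlusMCEtaKUpToMuCloser.plusMCEtaKUpToMu`), so the
glue 19868 needs only 19865 and 19867 (its closer: `Theorems.PlusMCEtaKSplitGlueProof.plusMCEtaKSplitGlue`).
No `sorry`; standard axioms.
References: [BurungaleTian2026] Thm. 2.6, Rem. 2.2, Rem. 2.7 (p. 4–5); [Kobayashi2003] Thm. 2.2 (p. 5),
§4 (p. 8); [Washington1997] §13.2 (structure theory of Λ-modules, `μ`/`λ`).
-/

namespace Summit.BirchSwinnertonDyer.BirchSwinnertonDyer.Theorems.PlusMCEtaKSplitLossless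

open Summit.BirchSwinnertonDyer.BirchSwinnertonDyer.Theses.InertBadSignedBranches

/-- **Losslessness of the 19501 split (item-level record)**: under the published inputs 19867,
`PlusMCEtaK ↔ PlusMCEtaKMuPart` — the residual child 19865 carries exactly the unprinted content of
19501 (Burungale–Tian 2026 Rem. 2.2: «The conjecture is still open for `p` non-split in `K`»). Pointwise
this is the landed kernel iff of p473177 (Burungale–Tian 2026 §4 `μ`-criterion on the route's datum).
[cite: BurungaleTian2026, Rem. 2.2 (p. 4), Thm. 2.6 and Rem. 2.7 (p. 5)] [cite: Kobayashi2003, §4 (p. 8)]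
[cite: Washington1997, §13.2] -/
theorem plusMCEtaK_iff_plusMCEtaKMuPart (hF : PublishedInputsEtaUpToP) :
    PlusMCEtaK ↔ PlusMCEtaKMuPart := by
  constructor
  · intro hK p _ hp K₀ _ _ _ _ η hη hη1 V _ _ N _ f hCM hgood hap hf ϖ hϖ κ γ hκ hγ hγK hvar Lp hLp D
    exact (Theorems.PlusMCEtaKUpToMu.plusMCEtaK_iff_muInvariant_eq_of_burungaleTian hF.1 hF.2 p hp K₀
      η hη hη1 V hCM hgood hap hf ϖ hϖ κ γ hκ hγ hγK hvar Lp hLp D).mp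
      (hK p hp K₀ η hη hη1 V hCM hgood hap hf ϖ hϖ κ γ hκ hγ hγK hvar Lp hLp D)
  · intro hμ p _ hp K₀ _ _ _ _ η hη hη1 V _ _ N _ f hCM hgood hap hf ϖ hϖ κ γ hκ hγ hγK hvar Lp hLp D
    exact (Theorems.PlusMCEtaKUpToMu.plusMCEtaK_iff_muInvariant_eq_of_burungaleTian hF.1 hF.2 p hp K₀
      η hη hη1 V hCM hgood hap hf ϖ hϖ κ γ hκ hγ hγK hvar Lp hLp D).mpr
      (hμ p hp K₀ η hη hη1 V hCM hgood hap hf ϖ hϖ κ γ hκ hγ hγK hvar Lp hLp D)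

/-- **19501 ⟹ its `μ`-part** under the published inputs: Kobayashi's even `η`-main conjecture
`Char X(D) = (Lp)` gives `μ(X(D)) = μ(Λ/(Lp))`.
[cite: BurungaleTian2026, Thm. 2.6 and Rem. 2.7 (p. 5)] [cite: Kobayashi2003, §4 (p. 8)] -/
theorem plusMCEtaKMuPart_of_plusMCEtaK (hF : PublishedInputsEtaUpToP) (hK : PlusMCEtaK) :
    PlusMCEtaKMuPart :=
  (plusMCEtaK_iff_plusMCEtaKMuPart hF).mp hK

/-- **The `μ`-part ⟹ 19501** under the published inputs (this is the glue 19868 with its idle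
binder `PlusMCEtaKUpToMu` dropped — that child holds outright).
[cite: BurungaleTian2026, Thm. 2.6 and Rem. 2.7 (p. 5)] [cite: Kobayashi2003, Thm. 2.2 (p. 5), §4 (p. 8)] -/
theorem plusMCEtaK_of_plusMCEtaKMuPart (hF : PublishedInputsEtaUpToP) (hμ : PlusMCEtaKMuPart) :
    PlusMCEtaK :=
  (plusMCEtaK_iff_plusMCEtaKMuPart hF).mpr hμ

end Summit.BirchSwinnertonDyer.BirchSwinnertonDyer.Theorems.PlusMCEtaKSplitLossless
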